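import Mathlib
import Literature.NumberTheory.Transcendental.BakerLogarithmsConclusion
import Summits.Schanuel.Schanuel.Theses.RigidCore
import Summits.Schanuel.Schanuel.Theorems.RigidCoreTwoLogsBranchRelationFiniteCoprime
import Summits.Schanuel.Schanuel.Theorems.RigidCoreTwoLogsBranchRelationFiniteAbsIrred
import Summits.Schanuel.Schanuel.Theorems.RigidCoreTwoLogsBranchRelationFiniteCoeffs

/-!
# Theorem L (m = 2): an algebraic relation between two logarithms survives on only finitely many pairs of branches

Route RigidCore, support item stmt-Schanuel-0975 (`TwoLogsBranchRelationFinite`): for `l₁, l₂ ∈ ℂ`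
with `e^{l₁}, e^{l₂}` algebraic and `l₁, l₂, 2πi` linearly independent over `ℚ`, and any
non-constant `R ∈ ℚ̄[z, w]`, the set of `(j, k) ∈ ℤ²` with `R(l₁ + 2πi j, l₂ + 2πi k) = 0` is finite.

Proof (unconditional; the only transcendence input is Baker's theorem `baker_holds`, which gives the
`ℚ̄`-linear independence of `1, l₁, l₂, 2πi`):
* reduce to `R` irreducible over `ℚ̄` (induction over an irreducible factorisation);
* `ℚ̄` is algebraically closed, so `R` stays irreducible over `ℂ`
  (`RigidCore.TwoLogs.irreducible_map_of_isAlgClosed`), hence so does `P := R(l + tX) ∈ ℂ[X₀, X₁]`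
  (`t = 2πi`; the affine substitution is an automorphism);
* with an `ℚ̄`-linear `φ : ℂ → ℚ̄`, `φ(t^d) = 1`, the polynomial `f := ∑ φ(coeff n P) Xⁿ ∈ ℚ̄[X]`
  vanishes at all integer zeros of `P`, has degree `≤ d` and the same top form as `R`;
* either `P`, `f` are relatively prime — finitely many common zeros
  (`RigidCore.TwoLogs.finite_commonZeros_of_isRelPrime`, resultants) — or `P ∣ f`, and then the
  next-to-top coefficients of `P` (`RigidCore.TwoLogs.coeff_aeval_affine_next`) produce a
  `ℚ̄`-linear relation among `1, l₁, l₂, t` killing the top form of `R`: contradiction.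

References: A. Baker, *Transcendental Number Theory* (1975), Thm 2.1; idea card
period-lattice-rigidity-baker (Theorem L); refuter/grounder notes on the item (2026-08-15).
-/

noncomputable section

-- `Summit.Schanuel.Schanuel` is the tree's mandated `Summit.<Summit>.<Problem>` prefix (single-problem summit).
set_option linter.dupNamespace false

namespace Summit.Schanuel.Schanuel.Theorems

open MvPolynomial RigidCore.TwoLogs

set_option quotPrecheck false in
/-- The field of algebraic numbers, realised inside `ℂ`. -/
local notation "𝔸" => ↥(algebraicClosure ℚ ℂ)

/-- Coefficients of the "functional image" polynomial `∑ₙ φ(coeff n P) Xⁿ`. -/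
theorem coeff_sum_monomial_apply (φ : ℂ →ₗ[𝔸] 𝔸) (P : MvPolynomial (Fin 2) ℂ) (n : Fin 2 →₀ ℕ) :
    coeff n (∑ m ∈ P.support, monomial m (φ (coeff m P))) = φ (coeff n P) := by
  classical
  rw [coeff_sum]
  simp_rw [coeff_monomial]
  rw [Finset.sum_ite_eq']
  split_ifs with h
  · rfl
  · rw [notMem_support_iff.mp h, map_zero]

/-- Evaluating the functional image `∑ₙ φ(coeff n P) Xⁿ` at an `𝔸`-rational point gives `φ` of
the value of `P` (the functional is `𝔸`-linear and the monomials take values in `𝔸`). -/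
theorem eval_sum_monomial_apply (φ : ℂ →ₗ[𝔸] 𝔸) (P : MvPolynomial (Fin 2) ℂ) (x : Fin 2 → 𝔸) :
    eval x (∑ m ∈ P.support, monomial m (φ (coeff m P))) =
      φ (eval (fun i => algebraMap 𝔸 ℂ (x i)) P) := by
  rw [map_sum, MvPolynomial.eval_eq' (fun i => algebraMap 𝔸 ℂ (x i)) P, map_sum]
  refine Finset.sum_congr rfl (fun m _ => ?_)
  rw [eval_monomial, Finsupp.prod_fintype _ _ (fun i => pow_zero _)]
  have : (coeff m P * ∏ i, (algebraMap 𝔸 ℂ (x i)) ^ (m i)) = (∏ i, x i ^ (m i)) • coeff m P := by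
    rw [Algebra.smul_def, map_prod, mul_comm]
    simp only [map_pow]
  rw [this, map_smul, smul_eq_mul, mul_comm]

/-- **The irreducible case of Theorem L (m = 2).** Let `1, l₀, l₁, t` be linearly independent over
`𝔸 = ℚ̄` (for logarithms of algebraic numbers and `t = 2πi` this is Baker's theorem) with `t ≠ 0`,
and let `R ∈ 𝔸[X₀, X₁]` be irreducible. Then `R(l₀ + t j, l₁ + t k) = 0` for only finitely many
`(j, k) ∈ ℤ²`.

Proof: `P := R(l + tX) ∈ ℂ[X₀,X₁]` is irreducible (absolute irreducibility of `R` over the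
algebraically closed field `𝔸`, transported along the affine automorphism). Choose an `𝔸`-linear
`φ : ℂ → 𝔸` with `φ(t^d) = 1` (`d = deg R`) and put `f := ∑ φ(coeff n P) Xⁿ ∈ 𝔸[X]`; it vanishes at
every integer zero of `P`, has total degree `≤ d`, and its top form is that of `R`. Either `P` and
`f` are relatively prime — then they have finitely many common zeros — or `P ∣ f`, which by degree
forces `f = c • P` with `c t^d = 1`; reading off a coefficient of degree `d - 1` gives an `𝔸`-linear
relation among `1, l₀, l₁, t` whose `l`-coefficients are (positive multiples of) top-degree
coefficients of `R`, so the top form of `R` vanishes — a contradiction. -/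
theorem finite_zeros_of_irreducible (l : Fin 2 → ℂ) (t : ℂ) (ht : t ≠ 0)
    (hli : LinearIndependent 𝔸 ![(1 : ℂ), l 0, l 1, t])
    (R : MvPolynomial (Fin 2) 𝔸) (hR : Irreducible R) :
    {p : ℤ × ℤ | aeval (fun i => l i + t * ((![p.1, p.2] : Fin 2 → ℤ) i : ℂ)) R = 0}.Finite := by
  classical
  haveI : IsAlgClosure ℚ 𝔸 := algebraicClosure.isAlgClosure ℚ ℂ
  haveI : IsAlgClosed 𝔸 := IsAlgClosure.isAlgClosed ℚ
  set ι : 𝔸 →+* ℂ := algebraMap 𝔸 ℂ with hι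
  have hιinj : Function.Injective ι := ι.injective
  set d := R.totalDegree with hd
  set g : Fin 2 → MvPolynomial (Fin 2) ℂ := fun i => C (l i) + C t * X i with hg
  set P : MvPolynomial (Fin 2) ℂ := aeval g R with hP
  have hR0 : R ≠ 0 := hR.ne_zero
  -- (1) `P` as a substitution into `map ι R`
  have hPmap : P = aeval g (map ι R) := (aeval_map_algebraMap ℂ g R).symm
  have hsupp : (map ι R).support = R.support := support_map_of_injective R hιinj
  have hdeg' : (map ι R).totalDegree = d := by simp only [totalDegree, hsupp, hd]
  -- (2) `P` is irreducible
  have hPirr : Irreducible P := by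
    have h1 : Irreducible (map ι R) := irreducible_map_of_isAlgClosed hR
    -- the affine substitution is an automorphism of `ℂ[X₀, X₁]`
    set g' : Fin 2 → MvPolynomial (Fin 2) ℂ := fun i => C (-(l i) * t⁻¹) + C t⁻¹ * X i with hg'
    have hc1 : (aeval g : MvPolynomial (Fin 2) ℂ →ₐ[ℂ] MvPolynomial (Fin 2) ℂ).comp (aeval g') =
        AlgHom.id ℂ _ := by
      apply MvPolynomial.algHom_ext
      intro i
      simp only [AlgHom.comp_apply, AlgHom.id_apply, aeval_X, aeval_C, hg, hg', map_add, map_mul,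
        algebraMap_eq]
      calc _ = (C (-(l i) * t⁻¹ + t⁻¹ * l i) + C (t⁻¹ * t) * X i : MvPolynomial (Fin 2) ℂ) := by
            simp only [map_add, map_mul]; ring
        _ = X i := by
            rw [inv_mul_cancel₀ ht, show -(l i) * t⁻¹ + t⁻¹ * l i = 0 by ring, C_0, C_1]; ring
    have hc2 : (aeval g' : MvPolynomial (Fin 2) ℂ →ₐ[ℂ] MvPolynomial (Fin 2) ℂ).comp (aeval g) =
        AlgHom.id ℂ _ := by
      apply MvPolynomial.algHom_ext
      intro i
      simp only [AlgHom.comp_apply, AlgHom.id_apply, aeval_X, aeval_C, hg, hg', map_add, map_mul,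
        algebraMap_eq]
      calc _ = (C (l i + -(l i) * (t⁻¹ * t)) + C (t * t⁻¹) * X i : MvPolynomial (Fin 2) ℂ) := by
            simp only [map_add, map_mul]; ring
        _ = X i := by
            rw [inv_mul_cancel₀ ht, mul_inv_cancel₀ ht, show l i + -(l i) * 1 = 0 by ring, C_0, C_1]
            ring
    let E : MvPolynomial (Fin 2) ℂ ≃ₐ[ℂ] MvPolynomial (Fin 2) ℂ :=
      AlgEquiv.ofAlgHom (aeval g) (aeval g') hc1 hc2
    have hE : ∀ q, E q = aeval g q := fun q => rfl
    rw [hPmap, ← hE]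
    exact (MulEquiv.irreducible_iff E).mpr h1
  -- (3) evaluation of `P` at a point with coordinates in the image of `𝔸`... in fact any point
  have heval : ∀ x : Fin 2 → ℂ, eval x P = aeval (fun i => l i + t * x i) R := by
    intro x
    have hhom : (eval x).comp
        (aeval g : MvPolynomial (Fin 2) 𝔸 →ₐ[𝔸] MvPolynomial (Fin 2) ℂ).toRingHom =
        (aeval (fun i => l i + t * x i) : MvPolynomial (Fin 2) 𝔸 →ₐ[𝔸] ℂ).toRingHom := by
      apply MvPolynomial.ringHom_ext
      · intro r
        simp [MvPolynomial.algebraMap_apply]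
      · intro i
        simp [hg]
    exact RingHom.congr_fun hhom R
  -- (4) top monomial and coefficient facts
  obtain ⟨n₀, hn₀, hdn₀⟩ := Finset.exists_mem_eq_sup R.support (support_nonempty.mpr hR0)
    (fun s => s.sum fun _ e => e)
  have hn₀d : n₀ 0 + n₀ 1 = d := by
    rw [← degree_fin_two]; exact hdn₀.symm
  have hr₀ : coeff n₀ R ≠ 0 := mem_support_iff.mp hn₀
  have hd1 : 1 ≤ d := by
    by_contra hlt
    have h0 : R.totalDegree = 0 := by omega
    apply hR.not_isUnit
    rw [isUnit_iff_totalDegree_of_isReduced, isUnit_iff_ne_zero]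
    refine ⟨?_, h0⟩
    intro hc
    apply hR0
    rw [totalDegree_eq_zero_iff_eq_C] at h0
    rw [h0, hc, C_0]
  have cP_top : ∀ n : Fin 2 →₀ ℕ, n 0 + n 1 = d → coeff n P = t ^ d * ι (coeff n R) := by
    intro n hn
    rw [hPmap, coeff_aeval_affine_top l t (map ι R) n (by rw [hdeg']; exact hn), coeff_map, hn]
  have cP_next : ∀ n : Fin 2 →₀ ℕ, n 0 + n 1 + 1 = d → coeff n P =
      t ^ (n 0 + n 1) * (ι (coeff n R)
        + ((n 0 + 1 : ℕ) : ℂ) * ι (coeff (n + Finsupp.single 0 1) R) * l 0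
        + ((n 1 + 1 : ℕ) : ℂ) * ι (coeff (n + Finsupp.single 1 1) R) * l 1) := by
    intro n hn
    rw [hPmap, coeff_aeval_affine_next l t (map ι R) n (by rw [hdeg']; exact hn)]
    simp only [coeff_map]
  have cP_zero : ∀ n : Fin 2 →₀ ℕ, d < n 0 + n 1 → coeff n P = 0 := by
    intro n hn
    by_contra h
    have := degree_le_of_coeff_aeval_affine_ne_zero l t (map ι R) n (by rw [← hPmap]; exact h)
    rw [hdeg'] at this
    omega
  have hPn₀ : coeff n₀ P ≠ 0 := by
    rw [cP_top n₀ hn₀d]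
    exact mul_ne_zero (pow_ne_zero _ ht) ((map_ne_zero_iff ι hιinj).mpr hr₀)
  have hP0 : P ≠ 0 := fun h => hPn₀ (by rw [h, coeff_zero])
  have hPdeg : P.totalDegree = d := by
    apply le_antisymm
    · apply Finset.sup_le
      intro n hn
      rw [degree_fin_two]
      by_contra hlt
      exact (mem_support_iff.mp hn) (cP_zero n (by omega))
    · have := le_totalDegree (mem_support_iff.mpr hPn₀)
      rw [degree_fin_two, hn₀d] at this
      exact this
  -- (5) an `𝔸`-linear functional with `φ (t ^ d) = 1`
  obtain ⟨φ, hφ⟩ : ∃ φ : ℂ →ₗ[𝔸] 𝔸, φ (t ^ d) = 1 := by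
    have htd : (t ^ d : ℂ) ≠ 0 := pow_ne_zero _ ht
    obtain ⟨γ, hγ⟩ := LinearMap.exists_leftInverse_of_injective
      (LinearMap.toSpanSingleton 𝔸 ℂ (t ^ d)) (LinearMap.ker_toSpanSingleton 𝔸 htd)
    refine ⟨γ, ?_⟩
    have := LinearMap.congr_fun hγ 1
    simpa [LinearMap.toSpanSingleton_apply] using this
  -- (6) the functional image `f₁` and its base change `f₁'`
  set f₁ : MvPolynomial (Fin 2) 𝔸 := ∑ m ∈ P.support, monomial m (φ (coeff m P)) with hf₁
  have cf₁ : ∀ n, coeff n f₁ = φ (coeff n P) := fun n => coeff_sum_monomial_apply φ P n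
  have hφn₀ : φ (coeff n₀ P) = coeff n₀ R := by
    rw [cP_top n₀ hn₀d, show t ^ d * ι (coeff n₀ R) = (coeff n₀ R) • (t ^ d) by
      rw [Algebra.smul_def, mul_comm], map_smul, hφ, smul_eq_mul, mul_one]
  have hf₁0 : f₁ ≠ 0 := by
    intro h
    apply hr₀
    rw [← hφn₀, ← cf₁, h, coeff_zero]
  set f₁' : MvPolynomial (Fin 2) ℂ := map ι f₁ with hf₁'
  have hf₁'0 : f₁' ≠ 0 := by
    intro h
    exact hf₁0 ((map_injective ι hιinj) (by rw [← hf₁', h, map_zero]))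
  have hf₁'deg : f₁'.totalDegree ≤ d := by
    apply Finset.sup_le
    intro n hn
    rw [degree_fin_two]
    by_contra hlt
    apply mem_support_iff.mp hn
    rw [hf₁', coeff_map, cf₁, cP_zero n (by omega), map_zero, map_zero]
  -- (7) dichotomy: `P ∣ f₁'` or the two are relatively prime
  rcases hPirr.dvd_or_isRelPrime (n := f₁') with hdvd | hrel
  · exfalso
    obtain ⟨q, hq⟩ := hdvd
    have hq0 : q ≠ 0 := by
      rintro rfl
      exact hf₁'0 (by rw [hq, mul_zero])
    have hqdeg : q.totalDegree = 0 := by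
      have := totalDegree_mul_of_isDomain hP0 hq0
      rw [← hq, hPdeg] at this
      omega
    rw [totalDegree_eq_zero_iff_eq_C] at hqdeg
    set c := coeff 0 q with hc
    have hcoef : ∀ n, ι (φ (coeff n P)) = coeff n P * c := by
      intro n
      have := congrArg (coeff n) hq
      rw [hf₁', coeff_map, cf₁, hqdeg, mul_comm, coeff_C_mul] at this
      rw [this, mul_comm]
    have htc : t ^ d * c = 1 := by
      have h1 := hcoef n₀
      rw [hφn₀, cP_top n₀ hn₀d] at h1
      have hι0 : ι (coeff n₀ R) ≠ 0 := (map_ne_zero_iff ι hιinj).mpr hr₀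
      have : ι (coeff n₀ R) * (t ^ d * c) = ι (coeff n₀ R) * 1 := by rw [mul_one]; linear_combination h1.symm
      exact mul_left_cancel₀ hι0 this
    -- a degree-`d-1` exponent `n` with `n + eᵢ = n₀`
    have hex : ∃ (i : Fin 2) (n : Fin 2 →₀ ℕ), n + Finsupp.single i 1 = n₀ := by
      by_cases h0 : n₀ 0 = 0
      · have h1 : 1 ≤ n₀ 1 := by omega
        exact ⟨1, n₀ - Finsupp.single 1 1, tsub_add_cancel_of_le (Finsupp.single_le_iff.mpr h1)⟩
      · exact ⟨0, n₀ - Finsupp.single 0 1,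
          tsub_add_cancel_of_le (Finsupp.single_le_iff.mpr (Nat.one_le_iff_ne_zero.mpr h0))⟩
    obtain ⟨i, n, hn⟩ := hex
    have hnd : n 0 + n 1 + 1 = d := by
      rw [← hn₀d, ← hn]
      fin_cases i <;> simp <;> ring
    set a := φ (coeff n P) with ha
    have key : ι a = coeff n P * c := hcoef n
    rw [cP_next n hnd] at key
    set B := ι (coeff n R) + ((n 0 + 1 : ℕ) : ℂ) * ι (coeff (n + Finsupp.single 0 1) R) * l 0
        + ((n 1 + 1 : ℕ) : ℂ) * ι (coeff (n + Finsupp.single 1 1) R) * l 1 with hB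
    have key2 : ι a * t = B := by
      have htpow : t ^ d = t ^ (n 0 + n 1) * t := by rw [← hnd, pow_succ]
      calc ι a * t = (t ^ (n 0 + n 1) * B * c) * t := by rw [key]
        _ = B * (t ^ d * c) := by rw [htpow]; ring
        _ = B := by rw [htc, mul_one]
    -- the linear relation among `1, l 0, l 1, t`
    have hcomb := (Fintype.linearIndependent_iff.mp hli)
      ![coeff n R, ((n 0 + 1 : ℕ) : 𝔸) * coeff (n + Finsupp.single 0 1) R,
        ((n 1 + 1 : ℕ) : 𝔸) * coeff (n + Finsupp.single 1 1) R, -a] (by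
        rw [Fin.sum_univ_four]
        simp only [Matrix.cons_val_zero, Matrix.cons_val_one, Matrix.cons_val_two,
          Matrix.cons_val_three, Matrix.head_cons, Matrix.tail_cons, Algebra.smul_def, map_mul,
          map_natCast, map_neg, ← hι]
        rw [hB] at key2
        linear_combination -key2)
    have hc1 := hcomb 1
    have hc2 := hcomb 2
    simp only [Matrix.cons_val_zero, Matrix.cons_val_one, Matrix.head_cons, Matrix.cons_val_two,
      Matrix.tail_cons, mul_eq_zero, Nat.cast_eq_zero, Nat.succ_ne_zero, false_or] at hc1 hc2
    fin_cases i
    · apply hr₀; rw [← hn]; simpa using hc1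
    · apply hr₀; rw [← hn]; simpa using hc2
  · -- relatively prime: finitely many common zeros in `ℂ²`, and the integer points inject
    have hfin := finite_commonZeros_of_isRelPrime hP0 hrel
    let Φ : ℤ × ℤ → (Fin 2 → ℂ) := fun p i => (((![p.1, p.2] : Fin 2 → ℤ) i : ℤ) : ℂ)
    have hΦ : Function.Injective Φ := by
      intro p p' h
      have h0 := congrFun h 0
      have h1 := congrFun h 1
      simp only [Φ, Matrix.cons_val_zero, Matrix.cons_val_one, Int.cast_inj] at h0 h1
      exact Prod.ext h0 h1
    refine (hfin.preimage hΦ.injOn).subset ?_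
    intro p hp
    simp only [Set.mem_setOf_eq] at hp
    simp only [Set.mem_preimage, Set.mem_setOf_eq]
    refine ⟨by rw [heval]; exact hp, ?_⟩
    have hx : Φ p = fun i => ι ((((![p.1, p.2] : Fin 2 → ℤ) i : ℤ) : 𝔸)) := by
      funext i; simp [Φ]
    have h2 : eval (Φ p) f₁' = ι (eval (fun i => ((((![p.1, p.2] : Fin 2 → ℤ) i : ℤ) : 𝔸))) f₁) := by
      have h2' := MvPolynomial.eval₂_comp_left ι (RingHom.id _)
        (fun i => ((((![p.1, p.2] : Fin 2 → ℤ) i : ℤ) : 𝔸))) f₁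
      rw [RingHom.comp_id] at h2'
      rw [hf₁', eval_map, hx]
      exact h2'.symm
    rw [h2, hf₁, eval_sum_monomial_apply, ← hx, heval, hp, map_zero, map_zero]


/-- Finiteness for every nonzero `R`, by induction over an irreducible factorisation. -/
theorem finite_zeros_of_ne_zero (l : Fin 2 → ℂ) (t : ℂ) (ht : t ≠ 0)
    (hli : LinearIndependent 𝔸 ![(1 : ℂ), l 0, l 1, t])
    (R : MvPolynomial (Fin 2) 𝔸) (hR : R ≠ 0) :
    {p : ℤ × ℤ | aeval (fun i => l i + t * ((![p.1, p.2] : Fin 2 → ℤ) i : ℂ)) R = 0}.Finite := by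
  induction R using WfDvdMonoid.induction_on_irreducible with
  | zero => exact absurd rfl hR
  | unit u hu =>
    obtain ⟨c, hc, rfl⟩ := isUnit_iff_eq_C_of_isReduced.mp hu
    have hc0 : algebraMap 𝔸 ℂ c ≠ 0 :=
      (map_ne_zero_iff _ (algebraMap 𝔸 ℂ).injective).mpr hc.ne_zero
    convert Set.finite_empty
    ext p
    simp only [Set.mem_setOf_eq, Set.mem_empty_iff_false, iff_false, aeval_C]
    exact hc0
  | mul a q ha hq IH =>
    have hZ : {p : ℤ × ℤ | aeval (fun i => l i + t * ((![p.1, p.2] : Fin 2 → ℤ) i : ℂ)) (q * a) = 0}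
        = {p : ℤ × ℤ | aeval (fun i => l i + t * ((![p.1, p.2] : Fin 2 → ℤ) i : ℂ)) q = 0}
          ∪ {p : ℤ × ℤ | aeval (fun i => l i + t * ((![p.1, p.2] : Fin 2 → ℤ) i : ℂ)) a = 0} := by
      ext p
      simp only [Set.mem_setOf_eq, Set.mem_union, map_mul, mul_eq_zero]
    rw [hZ]
    exact (finite_zeros_of_irreducible l t ht hli q hq).union (IH ha)

/-- **Theorem L (m = 2), route support `TwoLogsBranchRelationFinite` (item stmt-Schanuel-0975).**
For logarithms `l₁, l₂` of algebraic numbers with `l₁, l₂, 2πi` linearly independent over `ℚ` and a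
non-constant `R ∈ ℚ̄[z, w]`, the relation `R(l₁ + 2πi j, l₂ + 2πi k) = 0` holds for only finitely many
`(j, k) ∈ ℤ²`. Unconditional: the only transcendence input is Baker's theorem
(`Literature.NumberTheory.Transcendental.baker_holds`, Baker 1975 Thm 2.1), which makes
`1, l₁, l₂, 2πi` linearly independent over `ℚ̄`; the rest is the `ℚ̄`-structure / top-degree
argument of `finite_zeros_of_irreducible`. -/
theorem TwoLogsBranchRelationFinite_proof :
    Summit.Schanuel.Schanuel.Theses.RigidCore.TwoLogsBranchRelationFinite := by
  intro l₁ l₂ h₁ h₂ hli R hRdeg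
  set t : ℂ := 2 * ↑Real.pi * Complex.I with ht_def
  have ht : t ≠ 0 := by
    simp only [ht_def, ne_eq, mul_eq_zero, OfNat.ofNat_ne_zero, Complex.ofReal_eq_zero,
      Real.pi_ne_zero, Complex.I_ne_zero, or_self, not_false_eq_true]
  -- Baker: `1, l₁, l₂, 2πi` are linearly independent over `ℚ̄`
  have h₃ : IsAlgebraic ℚ (Complex.exp t) := by
    rw [ht_def, Complex.exp_two_pi_mul_I]
    exact isAlgebraic_one
  have halg : ∀ i, IsAlgebraic ℚ (Complex.exp ((![l₁, l₂, t] : Fin 3 → ℂ) i)) := by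
    intro i
    fin_cases i
    · simpa using h₁
    · simpa using h₂
    · simpa using h₃
  have hB := Literature.NumberTheory.Transcendental.baker_holds (![l₁, l₂, t] : Fin 3 → ℂ) halg hli
  have hli4 : LinearIndependent 𝔸 ![(1 : ℂ), (![l₁, l₂] : Fin 2 → ℂ) 0, (![l₁, l₂] : Fin 2 → ℂ) 1, t] := by
    let e : Fin 4 → Option (Fin 3) := ![none, some 0, some 1, some 2]
    have he : Function.Injective e := by
      intro i j hij
      fin_cases i <;> fin_cases j <;> simp_all [e]
    have := hB.comp e he
    convert this using 1
    funext i
    fin_cases i <;> rfl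
  have hR0 : R ≠ 0 := by
    rintro rfl
    simp at hRdeg
  have hfin := finite_zeros_of_ne_zero ![l₁, l₂] t ht hli4 R hR0
  -- the two descriptions of the evaluation points agree
  have hpt : ∀ p : ℤ × ℤ, (![l₁ + t * (p.1 : ℂ), l₂ + t * (p.2 : ℂ)] : Fin 2 → ℂ) =
      fun i => (![l₁, l₂] : Fin 2 → ℂ) i + t * ((![p.1, p.2] : Fin 2 → ℤ) i : ℂ) := by
    intro p
    funext i
    fin_cases i <;> simp
  have hset : {p : ℤ × ℤ | aeval (![l₁ + t * (p.1 : ℂ), l₂ + t * (p.2 : ℂ)] : Fin 2 → ℂ) R = 0} =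
      {p : ℤ × ℤ | aeval (fun i => (![l₁, l₂] : Fin 2 → ℂ) i + t * ((![p.1, p.2] : Fin 2 → ℤ) i : ℂ))
        R = 0} := by
    ext p
    rw [Set.mem_setOf_eq, Set.mem_setOf_eq, hpt p]
  rw [hset]
  exact hfin

end Summit.Schanuel.Schanuel.Theorems
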